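import Mathlib.RingTheory.Polynomial.Resultant.Basic
import Mathlib.RingTheory.Polynomial.UniqueFactorization
import Mathlib.RingTheory.MvPolynomial.Homogeneous
import Mathlib.RingTheory.MvPolynomial.EulerIdentity
import Mathlib.Algebra.MvPolynomial.Equiv
import Mathlib.Algebra.MvPolynomial.Funext
import Mathlib.Algebra.MvPolynomial.NoZeroDivisors
import Mathlib.Algebra.MvPolynomial.Nilpotent
import Mathlib.Algebra.CharZero.Infinite
import Mathlib.LinearAlgebra.CrossProduct
import Mathlib.LinearAlgebra.Matrix.ToLinearEquiv
import Literature.Computability.AlgebraicComplexity.DeterminantalConormalBound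
import Literature.Computability.AlgebraicComplexity.DeterminantalComplexityProofs
import Literature.RingTheory.MvPolynomial.BihomogeneousCoefficients
import HarnessLib

/-!
# Sheshadri's determinantal conormal bound — the case `N = 3` (plane curves), via the
# projective plane Bézout inequality and the Plücker class inequality

This file accompanies `DeterminantalConormalBound.lean` (the named fact
`Sheshadri2026_polarCount_le`, K. Sheshadri, arXiv:2606.13628, Thm. 3 (i) in polar-count form) and
`DeterminantalConormalBoundProofs.lean` (the elementary front end of the printed proof and the
degenerate range `2m < N`). It proves the fact's conclusion in its first case `N = |σ| = 3`
(`Sheshadri2026_polarCount_le_of_card_eq_three`): for a ternary form `f` of degree `d` with an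
affine determinantal representation of size `m`, generically `#T_f(a, b, c) ≤ B(m, 3) = 3·C(m,2)`.
For plane curves the polar count is the classical class-type count, and the bound follows from
the Plücker class inequality `#T_f(a,b,c) ≤ d(d − 1)` together with `d ≤ m`; no intersection
theory beyond the set-theoretic plane Bézout inequality is needed. (The cases `4 ≤ N ≤ 2m` are
the genuine content of the cited claim — a multihomogeneous Bézout count on
`ℙᴺ × ℙ^{m−1} × ℙ^{m−1}` — and are not formalised.)

## Contents (everything is a theorem; no definitions, no named facts — D-0026)

* §1 Resultants (`Polynomial.resultant`, Mathlib's Sylvester matrix): the isobaric property —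
  if the `Yⁱ`-coefficients of `F, H ∈ R[τ][Y]` are forms of degrees `e − i`, `e' − i` then
  `Res_{e,e'}(F, H)` is a form of degree `e e'` (`isHomogeneous_resultant`; Gibson 1998,
  Lemma 14.3); `Res ≠ 0` for relatively prime `F, H` over a UFD, from a kernel vector of the
  Sylvester matrix (`resultant_ne_zero_of_isRelPrime`; Gibson 1998, Lemma 14.2); a common zero
  kills the resultant (`eval_resultant_eq_zero_of_common_zero`, from Mathlib's Bézout identity
  `Polynomial.exists_mul_add_mul_eq_C_resultant`).
* §2–3 **Projective plane Bézout inequality, set-theoretic form** (`planeBezout_card_le`; Gibson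
  1998, Lemma 14.4 and its proof): two relatively prime ternary forms of degrees `e ≥ 1`, `e'`
  over an infinite field have at most `e e'` common zeros in `ℙ²` (any finite set of pairwise
  independent common zeros in `k³` has `≤ e e'` elements): project from a centre off `V(g)` and
  off the chords of the finite set, dehomogenise the resultant, count roots
  (`card_le_mul_of_normalized` is the count in normalised coordinates; the coordinate change is
  the substitution `xᵢ ↦ Σⱼ Bᵢⱼ xⱼ`, `eval_linSubst`, `isRelPrime_linSubst`). The weak Bézout
  theorem on an affine chart (`planeBezout_chart`): the common zeros with `c · x = 1` form a
  finite set of at most `e e'` elements.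
* §4 Factors of forms are forms (`isHomogeneous_of_mul_isHomogeneous`).
* §5 The polar set `T_f(a,b,c)` (`polarSet`) of a ternary form: on it the polar form
  `Σᵢ (a × b)ᵢ ∂ᵢ f` vanishes; reduction to the prime factors of multiplicity one
  (`mem_polarSet_mul`, `polarSet_pow_eq_empty`, `polarSet_C_mul_prod_pow_subset`,
  `polarSet_subset_iUnion_factors`); finiteness of `T_f(a,b,c)` whenever `f(a × b) ≠ 0`
  (`polarSet_finite_of_eval_cross_ne_zero`) and the **Plücker class inequality**
  `#T_f(a,b,c) ≤ d(d−1)` (`ncard_polarSet_le_of_isHomogeneous`: Bézout for each prime factor `p`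
  and its polar form, which is prime to `p` by Euler's identity at `a × b`,
  `isRelPrime_polarForm_of_mem_factors`; compare Gibson 1998, Lemma 14.10).
* §6 The genericity polynomial `Φ(u) = f(a × b)`, transfer along `σ ≃ Fin 3`, and
  `Sheshadri2026_polarCount_le_of_card_eq_three`.

## References

* C. G. Gibson, *Elementary Geometry of Algebraic Curves*, Cambridge University Press 1998,
  §14.2 Lemma 14.2, §14.3 Lemma 14.3, §14.4 Lemma 14.4 (weak Bézout), Lemma 14.10. [Gibson1998]
* K. Sheshadri, arXiv:2606.13628 (2026), Thm. 3 (i), Remark 3. [Sheshadri2026Border] —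
  unrefereed claim; only its case `n = N = 3` is touched here, where it is classical.
-/

namespace Literature.Computability.AlgebraicComplexity.DeterminantalConormal

open MvPolynomial
-- `φ(c • x) = cⁿ φ(x)` for a form of degree `n` is the tree's
-- `Literature.RingTheory.MvPolynomial.eval_smul_of_isHomogeneous` (reused, not restated).
open Literature.RingTheory.MvPolynomial (eval_smul_of_isHomogeneous)

section Resultant

open Polynomial

variable {R : Type*} [CommRing R] {τ : Type*}

/-- Entries of the Sylvester matrix, left block (coefficients of the second polynomial).
[folklore] -/
theorem sylvester_castAdd (F H : Polynomial R) (e e' : ℕ) (r : Fin (e + e')) (j : Fin e) :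
    sylvester F H e e' r (Fin.castAdd e' j) =
      if (j : ℕ) ≤ r ∧ (r : ℕ) ≤ j + e' then H.coeff (r - j) else 0 := by
  rw [sylvester, Matrix.of_apply, Fin.addCases_left]
  simp only [Set.mem_Icc]

/-- Entries of the Sylvester matrix, right block (coefficients of the first polynomial).
[folklore] -/
theorem sylvester_natAdd (F H : Polynomial R) (e e' : ℕ) (r : Fin (e + e')) (j : Fin e') :
    sylvester F H e e' r (Fin.natAdd e j) =
      if (j : ℕ) ≤ r ∧ (r : ℕ) ≤ j + e then F.coeff (r - j) else 0 := by
  rw [sylvester, Matrix.of_apply, Fin.addCases_right]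
  simp only [Set.mem_Icc]

/-- **Isobaric property of the Sylvester matrix.** If the `i`-th coefficient of `F` (resp. `H`)
is a form of degree `e − i` (resp. `e' − i`), then the entry `(r, c)` of `Syl_{e,e'}(F, H)` is a
form of degree `w(c) − r`, where the column weight `w(c)` is `e' + c` on the first `e` columns
and `c` on the last `e'` columns. [folklore] -/
theorem sylvester_isHomogeneous {F H : Polynomial (MvPolynomial τ R)} {e e' : ℕ}
    (hF : ∀ i, (F.coeff i).IsHomogeneous (e - i)) (hH : ∀ i, (H.coeff i).IsHomogeneous (e' - i))
    (r c : Fin (e + e')) :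
    (sylvester F H e e' r c).IsHomogeneous ((if (c : ℕ) < e then e' + c else c) - r) := by
  induction c using Fin.addCases with
  | left j =>
    rw [sylvester_castAdd, Fin.val_castAdd, if_pos j.isLt]
    split_ifs with h
    · convert hH (↑r - ↑j) using 1
      omega
    · exact isHomogeneous_zero _ _ _
  | right j =>
    rw [sylvester_natAdd, Fin.val_natAdd, if_neg (show ¬ (e + (j : ℕ) < e) by omega)]
    split_ifs with h
    · convert hF (↑r - ↑j) using 1
      omega
    · exact isHomogeneous_zero _ _ _

/-- An entry `(r, c)` of the Sylvester matrix below the band, `w(c) < r`, vanishes. [folklore] -/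
theorem sylvester_eq_zero_of_lt (F H : Polynomial R) (e e' : ℕ) (r c : Fin (e + e'))
    (h : (if (c : ℕ) < e then e' + c else c) < (r : ℕ)) : sylvester F H e e' r c = 0 := by
  induction c using Fin.addCases with
  | left j =>
    rw [Fin.val_castAdd, if_pos j.isLt] at h
    rw [sylvester_castAdd, if_neg (show ¬ ((j : ℕ) ≤ r ∧ (r : ℕ) ≤ j + e') by omega)]
  | right j =>
    rw [Fin.val_natAdd, if_neg (show ¬ (e + (j : ℕ) < e) by omega)] at h
    rw [sylvester_natAdd, if_neg (show ¬ ((j : ℕ) ≤ r ∧ (r : ℕ) ≤ j + e) by omega)]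

/-- **The resultant of two "binary-form-like" polynomials is a form of degree `e e'`.** If the
`i`-th coefficient of `F ∈ R[τ][Y]` is a form of degree `e − i` and the `i`-th coefficient of `H`
is a form of degree `e' − i` (as when `F`, `H` are forms of degrees `e`, `e'` in `τ ⊔ {Y}` written
as polynomials in `Y`), then `Res_{e,e'}(F, H) ∈ R[τ]` is a form of degree `e e'` (expand the
Sylvester determinant: every permutation term has this degree). [cite: Gibson1998, §14.3 Lemma 14.3] -/
theorem isHomogeneous_resultant {F H : Polynomial (MvPolynomial τ R)} {e e' : ℕ}
    (hF : ∀ i, (F.coeff i).IsHomogeneous (e - i)) (hH : ∀ i, (H.coeff i).IsHomogeneous (e' - i)) :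
    (resultant F H e e').IsHomogeneous (e * e') := by
  classical
  set w : Fin (e + e') → ℕ := fun c => if (c : ℕ) < e then e' + c else c with hw
  have hwsum : ∑ c, w c = e * e' + ∑ c : Fin (e + e'), (c : ℕ) := by
    have h2 : ∀ j : Fin e', ¬ (e + (j : ℕ) < e) := fun j => by omega
    simp only [hw, Fin.sum_univ_add, Fin.val_castAdd, Fin.val_natAdd, Fin.is_lt, if_true, h2,
      if_false, Finset.sum_add_distrib, Finset.sum_const, Finset.card_univ, Fintype.card_fin,
      smul_eq_mul]
    ring
  rw [resultant, Matrix.det_apply']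
  refine IsHomogeneous.sum _ _ _ fun σ _ => ?_
  rw [← map_intCast (C : R →+* MvPolynomial τ R)]
  refine IsHomogeneous.C_mul ?_ _
  by_cases hσ : ∀ c, ((σ c : Fin (e + e')) : ℕ) ≤ w c
  · have h := IsHomogeneous.prod Finset.univ (fun c => sylvester F H e e' (σ c) c)
      (fun c => w c - (σ c : ℕ)) (fun c _ => sylvester_isHomogeneous hF hH (σ c) c)
    have hdeg : ∑ c, (w c - ((σ c : Fin (e + e')) : ℕ)) = e * e' := by
      have h1 : ∑ c, (w c - ((σ c : Fin (e + e')) : ℕ)) + ∑ c, ((σ c : Fin (e + e')) : ℕ) =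
          ∑ c, w c := by
        rw [← Finset.sum_add_distrib]
        exact Finset.sum_congr rfl fun c _ => Nat.sub_add_cancel (hσ c)
      have h2 : ∑ c, ((σ c : Fin (e + e')) : ℕ) = ∑ c : Fin (e + e'), (c : ℕ) :=
        Equiv.sum_comp σ (fun c => (c : ℕ))
      omega
    rwa [hdeg] at h
  · push Not at hσ
    obtain ⟨c, hc⟩ := hσ
    rw [Finset.prod_eq_zero (f := fun i => sylvester F H e e' (σ i) i) (Finset.mem_univ c)
      (sylvester_eq_zero_of_lt F H e e' (σ c) c hc)]
    exact isHomogeneous_zero _ _ _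

/-- **Kernel form of `Res ≠ 0`.** Over a unique factorisation domain `A`: if `F, H ∈ A[Y]` are
relatively prime, `F ≠ 0` has degree exactly `e` and `deg H ≤ e'`, then `Res_{e,e'}(F, H) ≠ 0`
(a kernel vector of the Sylvester matrix is a pair `(p, q)`, `deg p < e`, `deg q < e'`, with
`F q + H p = 0`, whence `F ∣ p`, so `p = 0`, so `q = 0`). [cite: Gibson1998, §14.2 Lemma 14.2] -/
theorem resultant_ne_zero_of_isRelPrime {A : Type*} [CommRing A] [IsDomain A]
    [UniqueFactorizationMonoid A] {F H : A[X]} {e e' : ℕ} (hF0 : F ≠ 0) (hFe : F.natDegree = e)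
    (hHe : H.natDegree ≤ e') (hrel : IsRelPrime F H) : resultant F H e e' ≠ 0 := by
  classical
  intro hres
  obtain ⟨v, hv0, hv⟩ := Matrix.exists_mulVec_eq_zero_iff.mpr hres
  let b₁ := ((degreeLT.basis A e).prod (degreeLT.basis A e')).reindex finSumFinEquiv
  let b₂ := degreeLT.basis A (e + e')
  set x := b₁.equivFun.symm v with hx
  have hrepr : ⇑(b₁.repr x) = v := by
    rw [← Module.Basis.equivFun_apply, hx, LinearEquiv.apply_symm_apply]
  have hmap : sylvesterMap F H hFe.le hHe x = 0 := by
    have h := LinearMap.toMatrix_mulVec_repr b₁ b₂ (sylvesterMap F H hFe.le hHe) x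
    rw [toMatrix_sylvesterMap', hrepr, hv] at h
    have h' : b₂.repr (sylvesterMap F H hFe.le hHe x) = 0 := by
      ext i
      have := congr_fun h i
      rw [Pi.zero_apply] at this
      rw [← this, Finsupp.coe_zero, Pi.zero_apply]
    exact (LinearEquiv.map_eq_zero_iff _).mp h'
  have hx0 : x ≠ 0 := by
    intro h0
    apply hv0
    rw [← hrepr, h0, map_zero, Finsupp.coe_zero]
  have hpq : F * (x.2 : A[X]) + H * (x.1 : A[X]) = 0 := by
    have := congrArg Subtype.val hmap
    simpa [sylvesterMap] using this
  have hdvd : F ∣ (x.1 : A[X]) * H := by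
    refine ⟨-(x.2 : A[X]), ?_⟩
    rw [mul_neg, eq_neg_iff_add_eq_zero, mul_comm, ← hpq]
    ring
  have hp : (x.1 : A[X]) = 0 := by
    refine Polynomial.eq_zero_of_dvd_of_degree_lt (hrel.dvd_of_dvd_mul_right hdvd) ?_
    rw [degree_eq_natDegree hF0, hFe]
    exact mem_degreeLT.mp x.1.2
  have hq : (x.2 : A[X]) = 0 := by
    rw [hp, mul_zero, add_zero] at hpq
    exact (mul_eq_zero.mp hpq).resolve_left hF0
  exact hx0 (Prod.ext (Subtype.ext hp) (Subtype.ext hq))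

/-- **A common zero kills the resultant** (from the Bézout identity
`F p + H q = Res_{e,e'}(F, H)`, `Polynomial.exists_mul_add_mul_eq_C_resultant`): for
`F, H ∈ R[τ][Y]` with `deg_Y F ≤ e`, `deg_Y H ≤ e'`, `(e, e') ≠ (0, 0)`, if `F(y, t) = H(y, t) = 0`
then `Res_{e,e'}(F, H)(y) = 0`. [folklore] -/
theorem eval_resultant_eq_zero_of_common_zero {k : Type*} [CommRing k] {σ : Type*}
    {F H : Polynomial (MvPolynomial σ k)} {e e' : ℕ} (hF : F.natDegree ≤ e) (hH : H.natDegree ≤ e')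
    (he : e ≠ 0 ∨ e' ≠ 0) (y : σ → k) (t : k) (hFt : (F.map (eval y)).eval t = 0)
    (hHt : (H.map (eval y)).eval t = 0) : eval y (resultant F H e e') = 0 := by
  rw [← resultant_map_map F H e e' (eval y)]
  obtain ⟨p, q, -, -, hpq⟩ := exists_mul_add_mul_eq_C_resultant (F.map (eval y)) (H.map (eval y))
    (natDegree_map_le.trans hF) (natDegree_map_le.trans hH) he
  have := congrArg (Polynomial.eval t) hpq
  rw [Polynomial.eval_add, Polynomial.eval_mul, Polynomial.eval_mul, hFt, hHt, zero_mul, zero_mul,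
    add_zero, Polynomial.eval_C] at this
  exact this.symm

end Resultant

/-! ### Ternary forms: evaluation, dehomogenisation, and the normalised Bézout count -/

section TernaryForms

open Polynomial

variable {k : Type*} [Field k]

/-- The value of a form of degree `d` at the coordinate vector `eᵢ` is its `xᵢ^d`-coefficient.
[folklore] -/
theorem eval_single_one_of_isHomogeneous {σ : Type*} [DecidableEq σ] {φ : MvPolynomial σ k}
    {d : ℕ} (hφ : φ.IsHomogeneous d) (i : σ) :
    eval (Pi.single i 1) φ = coeff (Finsupp.single i d) φ := by
  rw [eval_eq]
  have key : ∀ m ∈ φ.support,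
      coeff m φ * ∏ j ∈ m.support, (Pi.single i (1 : k) : σ → k) j ^ m j =
        if m = Finsupp.single i d then coeff m φ else 0 := by
    intro m hm
    split_ifs with hmi
    · subst hmi
      by_cases hd : d = 0
      · simp [hd]
      · rw [Finsupp.support_single _ hd, Finset.prod_singleton, Pi.single_eq_same,
          one_pow, mul_one]
    · by_cases hsupp : ∃ j ∈ m.support, j ≠ i
      · obtain ⟨j, hj, hji⟩ := hsupp
        rw [Finset.prod_eq_zero hj, mul_zero]
        rw [Pi.single_eq_of_ne hji, zero_pow (Finsupp.mem_support_iff.mp hj)]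
      · push Not at hsupp
        exfalso
        apply hmi
        have hm' : m = Finsupp.single i (m i) := by
          ext j
          by_cases hji : j = i
          · subst hji; rw [Finsupp.single_eq_same]
          · rw [Finsupp.single_apply, if_neg (Ne.symm hji)]
            by_contra hne
            exact hji (hsupp j (Finsupp.mem_support_iff.mpr hne))
        have hsum : ∑ j ∈ m.support, m j = m i :=
          calc ∑ j ∈ m.support, m j = m.sum (fun _ n => n) := rfl
            _ = (Finsupp.single i (m i)).sum (fun _ n => n) := by rw [← hm']
            _ = m i := Finsupp.sum_single_index rfl
        have hdeg := hφ.degree_eq_sum_deg_support hm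
        rw [hsum] at hdeg
        rw [hm', ← hdeg]
  rw [Finset.sum_congr rfl key, Finset.sum_ite_eq']
  split_ifs with ha
  · rfl
  · exact (notMem_support_iff.mp ha).symm

/-- `Finsupp.cons e 0 = Finsupp.single 0 e`. [folklore] -/
theorem finsuppCons_zero_eq_single {n : ℕ} (e : ℕ) :
    (Finsupp.cons e (0 : Fin n →₀ ℕ)) = Finsupp.single 0 e := by
  ext j
  refine Fin.cases ?_ (fun j => ?_) j
  · rw [Finsupp.cons_zero, Finsupp.single_eq_same]
  · rw [Finsupp.cons_succ, Finsupp.coe_zero, Pi.zero_apply, Finsupp.single_apply,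
      if_neg (Fin.succ_ne_zero j).symm]

/-- The `Y^i`-coefficient of a form of degree `e` in `x₀ = Y, x₁, …, xₙ` is a form of degree
`e − i` in `x₁, …, xₙ`. [folklore] -/
theorem isHomogeneous_coeff_finSuccEquiv {n : ℕ} {g : MvPolynomial (Fin (n + 1)) k} {e : ℕ}
    (hg : g.IsHomogeneous e) (i : ℕ) : ((finSuccEquiv k n g).coeff i).IsHomogeneous (e - i) := by
  by_cases hi : i ≤ e
  · exact hg.finSuccEquiv_coeff_isHomogeneous i (e - i) (by omega)
  · rw [Polynomial.coeff_eq_zero_of_natDegree_lt]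
    · exact isHomogeneous_zero _ _ _
    · rw [natDegree_finSuccEquiv]
      exact lt_of_le_of_lt ((degreeOf_le_totalDegree g 0).trans hg.totalDegree_le) (by omega)

/-- `deg_Y` of a form of degree `e` is at most `e`. [folklore] -/
theorem natDegree_finSuccEquiv_le {n : ℕ} {g : MvPolynomial (Fin (n + 1)) k} {e : ℕ}
    (hg : g.IsHomogeneous e) : (finSuccEquiv k n g).natDegree ≤ e := by
  rw [natDegree_finSuccEquiv]
  exact (degreeOf_le_totalDegree g 0).trans hg.totalDegree_le

/-- `deg_Y` of a form of degree `e` with non-zero `x₀^e`-coefficient is exactly `e`. [folklore] -/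
theorem natDegree_finSuccEquiv_eq {n : ℕ} {g : MvPolynomial (Fin (n + 1)) k} {e : ℕ}
    (hg : g.IsHomogeneous e) (h0 : coeff (Finsupp.single 0 e) g ≠ 0) :
    (finSuccEquiv k n g).natDegree = e := by
  refine le_antisymm (natDegree_finSuccEquiv_le hg) (Polynomial.le_natDegree_of_ne_zero ?_)
  intro hc
  apply h0
  have := finSuccEquiv_coeff_coeff 0 g e
  rw [hc, MvPolynomial.coeff_zero, finsuppCons_zero_eq_single] at this
  exact this.symm

/-- Relative primality is transported by multiplicative equivalences. [folklore] -/
theorem isRelPrime_map_mulEquiv {M N : Type*} [Monoid M] [Monoid N] (φ : M ≃* N) {a b : M}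
    (h : IsRelPrime a b) : IsRelPrime (φ a) (φ b) := by
  intro d hda hdb
  have ha : φ.symm d ∣ a := by simpa using map_dvd φ.symm hda
  have hb : φ.symm d ∣ b := by simpa using map_dvd φ.symm hdb
  simpa using (h ha hb).map φ

/-- Evaluating a univariate specialisation of a multivariate polynomial. [folklore] -/
theorem polynomial_eval_aeval {σ : Type*} (v : σ → k[X]) (r : MvPolynomial σ k) (t : k) :
    (MvPolynomial.aeval v r).eval t = eval (fun j => (v j).eval t) r := by
  induction r using MvPolynomial.induction_on with
  | C a => simp
  | add p q hp hq => simp [hp, hq]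
  | mul_X p j hp => simp [hp]

/-- A substitution of polynomials of degree `≤ 1` does not raise the degree. [folklore] -/
theorem natDegree_aeval_le {σ : Type*} (v : σ → k[X]) (hv : ∀ j, (v j).natDegree ≤ 1)
    (r : MvPolynomial σ k) : (MvPolynomial.aeval v r).natDegree ≤ r.totalDegree := by
  classical
  rw [MvPolynomial.aeval_def, MvPolynomial.eval₂_eq]
  refine Polynomial.natDegree_sum_le_of_forall_le _ _ fun d hd => ?_
  calc ((algebraMap k k[X]) (coeff d r) * ∏ i ∈ d.support, v i ^ d i).natDegree
      ≤ (∏ i ∈ d.support, v i ^ d i).natDegree := by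
        rw [Polynomial.algebraMap_eq]; exact natDegree_C_mul_le _ _
    _ ≤ ∑ i ∈ d.support, (v i ^ d i).natDegree := natDegree_prod_le _ _
    _ ≤ ∑ i ∈ d.support, d i := Finset.sum_le_sum fun i _ =>
        natDegree_pow_le.trans (by nlinarith [hv i])
    _ ≤ r.totalDegree := le_totalDegree hd

/-- **Normalised projective plane Bézout inequality.** Let `g, h` be relatively prime ternary
forms of degrees `e ≥ 1` and `e'` over an infinite field, with `g(1,0,0) ≠ 0` (the projection
centre `(1:0:0)` off `V(g)`). Let `T` be a finite set of common zeros of `g, h` in `k³` with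
`y₂ ≠ 0` on `T` and such that `y ↦ (y₁ : y₂)` is injective on `T`. Then `|T| ≤ e e'`: the ratios
`y₁/y₂` are roots of the dehomogenised resultant `Res_Y(g, h)(t, 1)`, a non-zero polynomial of
degree `≤ e e'`. [cite: Gibson1998, §14.4 Lemma 14.4] -/
theorem card_le_mul_of_normalized [Infinite k] {g h : MvPolynomial (Fin 3) k} {e e' : ℕ}
    (hg : g.IsHomogeneous e) (hh : h.IsHomogeneous e') (he : e ≠ 0) (hrel : IsRelPrime g h)
    (hg0 : coeff (Finsupp.single 0 e) g ≠ 0) (T : Finset (Fin 3 → k))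
    (hTg : ∀ y ∈ T, eval y g = 0) (hTh : ∀ y ∈ T, eval y h = 0) (hT2 : ∀ y ∈ T, y 2 ≠ 0)
    (hinj : ∀ y ∈ T, ∀ y' ∈ T, y 1 * y' 2 = y' 1 * y 2 → y = y') :
    T.card ≤ e * e' := by
  classical
  set F := finSuccEquiv k 2 g with hF
  set H := finSuccEquiv k 2 h with hH
  set r := resultant F H e e' with hr_def
  have hr : r.IsHomogeneous (e * e') :=
    isHomogeneous_resultant (isHomogeneous_coeff_finSuccEquiv hg)
      (isHomogeneous_coeff_finSuccEquiv hh)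
  have hFe : F.natDegree = e := natDegree_finSuccEquiv_eq hg hg0
  have hF0 : F ≠ 0 := by
    rintro h0
    rw [h0, natDegree_zero] at hFe
    exact he hFe.symm
  have hr0 : r ≠ 0 :=
    resultant_ne_zero_of_isRelPrime hF0 hFe (natDegree_finSuccEquiv_le hh)
      (isRelPrime_map_mulEquiv (finSuccEquiv k 2).toMulEquiv hrel)
  -- the resultant vanishes at (the tails of) common zeros
  have hrz : ∀ y : Fin 3 → k, eval y g = 0 → eval y h = 0 → eval (Fin.tail y) r = 0 := by
    intro y hyg hyh
    refine eval_resultant_eq_zero_of_common_zero (natDegree_finSuccEquiv_le hg)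
      (natDegree_finSuccEquiv_le hh) (Or.inl he) (Fin.tail y) (y 0) ?_ ?_
    · rw [← eval_eq_eval_mv_eval', Fin.cons_self_tail, hyg]
    · rw [← eval_eq_eval_mv_eval', Fin.cons_self_tail, hyh]
  -- dehomogenise: `rb(t) = r(t, 1)`
  set v : Fin 2 → k[X] := fun j => if j = 0 then Polynomial.X else 1 with hv
  set rb : k[X] := MvPolynomial.aeval v r with hrb
  have hrb_eval : ∀ t : k, rb.eval t = eval (fun j : Fin 2 => if j = 0 then t else 1) r := by
    intro t
    rw [hrb, polynomial_eval_aeval]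
    have hfun : (fun j => (v j).eval t) = (fun j : Fin 2 => if j = 0 then t else 1) := by
      funext j
      by_cases hj : j = 0 <;> simp [hv, hj]
    rw [hfun]
  have hrb_deg : rb.natDegree ≤ e * e' :=
    (natDegree_aeval_le v (fun j => by by_cases hj : j = 0 <;> simp [hv, hj]) r).trans
      hr.totalDegree_le
  have hscale : ∀ z : Fin 2 → k, z 1 ≠ 0 → eval z r = z 1 ^ (e * e') * rb.eval (z 0 / z 1) := by
    intro z hz
    rw [hrb_eval, ← eval_smul_of_isHomogeneous hr]
    have hfun : z = z 1 • (fun j : Fin 2 => if j = 0 then z 0 / z 1 else 1) := by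
      funext j
      match j with
      | 0 => simp only [Pi.smul_apply, smul_eq_mul, if_true]; field_simp
      | 1 => simp
    exact congrArg (fun w => eval w r) hfun
  have hrb0 : rb ≠ 0 := by
    intro h0
    apply hr0
    have hX : (r * X 1).IsHomogeneous (e * e' + 1) := hr.mul (isHomogeneous_X k 1)
    have hzero : r * X 1 = 0 := by
      refine hX.eq_zero_of_forall_eval_eq_zero fun z => ?_
      rw [map_mul, MvPolynomial.eval_X]
      by_cases hz : z 1 = 0
      · rw [hz, mul_zero]
      · rw [hscale z hz, h0, Polynomial.eval_zero, mul_zero, zero_mul]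
    exact (mul_eq_zero.mp hzero).resolve_right (X_ne_zero _)
  -- count the ratios `y₁ / y₂`
  have hmaps : Set.MapsTo (fun y : Fin 3 → k => y 1 / y 2) T rb.roots.toFinset := by
    intro y hy
    rw [Finset.mem_coe, Multiset.mem_toFinset, mem_roots hrb0]
    change rb.eval (y 1 / y 2) = 0
    have h2 : Fin.tail y 1 ≠ 0 := hT2 y hy
    have h := hscale (Fin.tail y) h2
    rw [hrz y (hTg y hy) (hTh y hy)] at h
    exact (mul_eq_zero.mp h.symm).resolve_left (pow_ne_zero _ h2)
  have hinjOn : Set.InjOn (fun y : Fin 3 → k => y 1 / y 2) T := by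
    intro y hy y' hy' hyy'
    simp only at hyy'
    rw [div_eq_div_iff (hT2 y hy) (hT2 y' hy')] at hyy'
    exact hinj y hy y' hy' hyy'
  calc T.card ≤ rb.roots.toFinset.card := Finset.card_le_card_of_injOn _ hmaps hinjOn
    _ ≤ rb.roots.card := Multiset.toFinset_card_le _
    _ ≤ rb.natDegree := card_roots' _
    _ ≤ e * e' := hrb_deg

end TernaryForms

/-! ### Linear changes of coordinates and the general projective plane Bézout inequality -/

section CoordinateChange

open Matrix

variable {k : Type*} [Field k] {σ : Type*}

/-- Evaluation commutes with substitution. [folklore] -/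
theorem eval_aeval_eq_eval {τ : Type*} (v : σ → MvPolynomial τ k) (y : τ → k)
    (p : MvPolynomial σ k) : eval y (aeval v p) = eval (fun i => eval y (v i)) p := by
  induction p using MvPolynomial.induction_on with
  | C a => simp
  | add p q hp hq => simp [hp, hq]
  | mul_X p j hp => simp [hp]

variable [Fintype σ]

/-- The linear substitution `xᵢ ↦ Σⱼ Bᵢⱼ xⱼ` is evaluation at `B y`: `(p ∘ B)(y) = p(B y)`.
[folklore] -/
theorem eval_linSubst (B : Matrix σ σ k) (y : σ → k) (p : MvPolynomial σ k) :
    eval y (aeval (fun i => ∑ j, C (B i j) * X j) p) = eval (B *ᵥ y) p := by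
  rw [eval_aeval_eq_eval]
  have hfun : (fun i => eval y (∑ j, C (B i j) * X j)) = B *ᵥ y := by
    funext i
    simp [Matrix.mulVec, dotProduct]
  rw [hfun]

/-- Composition of linear substitutions: `(p ∘ B') ∘ B = p ∘ (B' B)`. [folklore] -/
theorem linSubst_linSubst (B B' : Matrix σ σ k) (p : MvPolynomial σ k) :
    aeval (fun i => ∑ j, C (B i j) * X j) (aeval (fun i => ∑ j, C (B' i j) * X j) p) =
      aeval (fun i => ∑ j, C ((B' * B) i j) * X j) p := by
  induction p using MvPolynomial.induction_on with
  | C a => simp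
  | add p q hp hq => simp only [map_add, hp, hq]
  | mul_X p i hp =>
    simp only [map_mul, hp, aeval_X]
    congr 1
    simp only [map_sum, map_mul, aeval_C, aeval_X, Matrix.mul_apply, algebraMap_eq,
      Finset.mul_sum, Finset.sum_mul]
    rw [Finset.sum_comm]
    refine Finset.sum_congr rfl fun l _ => Finset.sum_congr rfl fun j _ => ?_
    ring

/-- The identity substitution. [folklore] -/
theorem linSubst_one [DecidableEq σ] (p : MvPolynomial σ k) :
    aeval (fun i => ∑ j, C ((1 : Matrix σ σ k) i j) * X j) p = p := by
  have : (fun i : σ => ∑ j, C ((1 : Matrix σ σ k) i j) * X j) = X := by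
    funext i
    rw [Finset.sum_eq_single i]
    · simp
    · intro j _ hji
      simp [Matrix.one_apply_ne (Ne.symm hji)]
    · intro hi
      exact absurd (Finset.mem_univ i) hi
  rw [this, aeval_X_left, AlgHom.id_apply]

/-- A linear substitution preserves forms of degree `n`. [folklore] -/
theorem isHomogeneous_linSubst (B : Matrix σ σ k) {p : MvPolynomial σ k} {n : ℕ}
    (hp : p.IsHomogeneous n) : (aeval (fun i => ∑ j, C (B i j) * X j) p).IsHomogeneous n := by
  have h := hp.aeval (fun i => ∑ j, C (B i j) * X j) (n := 1)
    (fun i => IsHomogeneous.sum _ _ _ fun j _ => isHomogeneous_C_mul_X _ _)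
  rwa [one_mul] at h

/-- An invertible linear substitution preserves relative primality (it is a ring automorphism
with inverse the substitution by `B⁻¹`). [folklore] -/
theorem isRelPrime_linSubst [DecidableEq σ] {B : Matrix σ σ k} (hB : IsUnit B.det)
    {g h : MvPolynomial σ k}
    (hrel : IsRelPrime g h) :
    IsRelPrime (aeval (fun i => ∑ j, C (B i j) * X j) g)
      (aeval (fun i => ∑ j, C (B i j) * X j) h) := by
  have back : ∀ p : MvPolynomial σ k,
      aeval (fun i => ∑ j, C (B⁻¹ i j) * X j) (aeval (fun i => ∑ j, C (B i j) * X j) p) = p := by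
    intro p
    rw [linSubst_linSubst, Matrix.mul_nonsing_inv B hB, linSubst_one]
  have forth : ∀ p : MvPolynomial σ k,
      aeval (fun i => ∑ j, C (B i j) * X j) (aeval (fun i => ∑ j, C (B⁻¹ i j) * X j) p) = p := by
    intro p
    rw [linSubst_linSubst, Matrix.nonsing_inv_mul B hB, linSubst_one]
  intro d hdg hdh
  have hdg' := map_dvd (aeval (fun i => ∑ j, C (B⁻¹ i j) * X j)) hdg
  have hdh' := map_dvd (aeval (fun i => ∑ j, C (B⁻¹ i j) * X j)) hdh
  rw [back] at hdg' hdh'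
  have hu := (hrel hdg' hdh').map (aeval (fun i => ∑ j, C (B i j) * X j))
  rwa [forth] at hu

/-- A non-zero polynomial over an infinite field has a non-root. [folklore] -/
theorem exists_point_eval_ne_zero [Infinite k] {τ : Type*} {p : MvPolynomial τ k} (hp : p ≠ 0) :
    ∃ x, eval x p ≠ 0 := by
  by_contra h
  push Not at h
  exact hp (MvPolynomial.funext fun x => by rw [h x, map_zero])

/-- The linear form `Σᵢ wᵢ xᵢ` evaluates to the dot product. [folklore] -/
theorem eval_linForm (w y : σ → k) : eval y (∑ i, C (w i) * X i) = w ⬝ᵥ y := by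
  simp [dotProduct]

/-- A linear form with a non-zero coefficient vector is non-zero. [folklore] -/
theorem linForm_ne_zero [DecidableEq σ] {w : σ → k} (hw : w ≠ 0) :
    (∑ i, C (w i) * X i : MvPolynomial σ k) ≠ 0 := by
  obtain ⟨i, hi⟩ := Function.ne_iff.mp hw
  intro h0
  have := eval_linForm w (Pi.single i 1)
  rw [h0, map_zero, dotProduct_single_one] at this
  exact hi this.symm

/-- `det [B u, B v, B w] = det B · det [u, v, w]`. [folklore] -/
theorem det_mulVec_three (B : Matrix (Fin 3) (Fin 3) k) (u v w : Fin 3 → k) :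
    Matrix.det ![B *ᵥ u, B *ᵥ v, B *ᵥ w] = B.det * Matrix.det ![u, v, w] := by
  simp only [Matrix.det_fin_three, Matrix.mulVec, dotProduct, Fin.sum_univ_three,
    Matrix.cons_val_zero, Matrix.cons_val_one, Matrix.cons_val_two, Matrix.head_cons,
    Matrix.tail_cons]
  ring

/-- A form of positive degree vanishing at `s ≠ 0` but not at `o` forces `s, o` to be linearly
independent. [folklore] -/
theorem linearIndependent_of_eval {g : MvPolynomial (Fin 3) k} {e : ℕ} (hg : g.IsHomogeneous e)
    {s o : Fin 3 → k} (hs : eval s g = 0) (ho : eval o g ≠ 0) (hs0 : s ≠ 0) :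
    LinearIndependent k ![s, o] := by
  rw [LinearIndependent.pair_iff]
  intro a b hab
  by_cases hb : b = 0
  · subst hb
    rw [zero_smul, add_zero] at hab
    exact ⟨(smul_eq_zero.mp hab).resolve_right hs0, rfl⟩
  · exfalso
    apply ho
    have ho' : o = (-(a / b)) • s := by
      have : b • o = -(a • s) := eq_neg_of_add_eq_zero_right hab
      calc o = b⁻¹ • (b • o) := by rw [smul_smul, inv_mul_cancel₀ hb, one_smul]
        _ = (-(a / b)) • s := by rw [this, smul_neg, smul_smul, ← neg_smul]; ring_nf
    rw [ho', eval_smul_of_isHomogeneous hg, hs, mul_zero]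

/-- **Projective plane Bézout inequality (set-theoretic).** Let `g, h` be relatively prime
ternary forms over an infinite field, `g ≠ 0` of degree `e ≥ 1` and `h` of degree `e'`. Then
every finite set `T` of common zeros of `g, h` in `k³` consisting of non-zero, pairwise
linearly independent vectors (i.e. of distinct points of `ℙ²`) has at most `e e'` elements.
Proof: choose a centre `o` with `g(o) ≠ 0` off all the lines joining two points of `T`
and coordinates `(o, b₁, b₂)` with no point of `T` on the line `o b₁`; in these coordinates
`card_le_mul_of_normalized` applies. [cite: Gibson1998, §14.4 Lemma 14.4] -/
theorem planeBezout_card_le [Infinite k] {g h : MvPolynomial (Fin 3) k} {e e' : ℕ}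
    (hg : g.IsHomogeneous e) (hh : h.IsHomogeneous e') (he : e ≠ 0) (hg0 : g ≠ 0)
    (hrel : IsRelPrime g h) (T : Finset (Fin 3 → k))
    (hTg : ∀ y ∈ T, eval y g = 0) (hTh : ∀ y ∈ T, eval y h = 0) (hT0 : ∀ y ∈ T, y ≠ 0)
    (hT : ∀ y ∈ T, ∀ y' ∈ T, y ≠ y' → LinearIndependent k ![y, y']) :
    T.card ≤ e * e' := by
  classical
  -- trivial if `T = ∅`
  rcases T.eq_empty_or_nonempty with hTe | ⟨s₀, hs₀⟩
  · rw [hTe, Finset.card_empty]; exact Nat.zero_le _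
  -- Step 1: the centre `o`
  obtain ⟨o, ho⟩ : ∃ o : Fin 3 → k, eval o g ≠ 0 ∧
      ∀ p ∈ T.offDiag, o ⬝ᵥ (p.1 ⨯₃ p.2) ≠ 0 := by
    have hP : g * ∏ p ∈ T.offDiag, (∑ i, C ((p.1 ⨯₃ p.2) i) * X i) ≠ 0 := by
      refine mul_ne_zero hg0 (Finset.prod_ne_zero_iff.mpr fun p hp => linForm_ne_zero ?_)
      rw [Finset.mem_offDiag] at hp
      exact crossProduct_ne_zero_iff_linearIndependent.mpr (hT _ hp.1 _ hp.2.1 hp.2.2)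
    obtain ⟨o, ho⟩ := exists_point_eval_ne_zero hP
    rw [map_mul, map_prod, mul_ne_zero_iff, Finset.prod_ne_zero_iff] at ho
    refine ⟨o, ho.1, fun p hp => ?_⟩
    have := ho.2 p hp
    rwa [eval_linForm, dotProduct_comm] at this
  have ho0 : o ≠ 0 := by
    rintro rfl
    apply ho.1
    have := eval_smul_of_isHomogeneous hg (0 : k) (0 : Fin 3 → k)
    rwa [zero_smul, zero_pow he, zero_mul] at this
  -- Step 2: the second basis vector `b₁`, with no point of `T` on the line `o b₁`
  obtain ⟨b₁, hb₁⟩ : ∃ b₁ : Fin 3 → k, ∀ s ∈ T, (s ⨯₃ o) ⬝ᵥ b₁ ≠ 0 := by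
    have hQ : ∏ s ∈ T, (∑ i, C ((s ⨯₃ o) i) * X i : MvPolynomial (Fin 3) k) ≠ 0 := by
      refine Finset.prod_ne_zero_iff.mpr fun s hs => linForm_ne_zero ?_
      exact crossProduct_ne_zero_iff_linearIndependent.mpr
        (linearIndependent_of_eval hg (hTg s hs) ho.1 (hT0 s hs))
    obtain ⟨b₁, hb₁⟩ := exists_point_eval_ne_zero hQ
    rw [map_prod, Finset.prod_ne_zero_iff] at hb₁
    exact ⟨b₁, fun s hs => by simpa only [eval_linForm] using hb₁ s hs⟩
  -- Step 3: the third basis vector `b₂`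
  have hw : o ⨯₃ b₁ ≠ 0 := by
    refine crossProduct_ne_zero_iff_linearIndependent.mpr (LinearIndependent.pair_iff.mpr ?_)
    intro a b hab
    by_cases hb : b = 0
    · subst hb
      rw [zero_smul, add_zero] at hab
      exact ⟨(smul_eq_zero.mp hab).resolve_right ho0, rfl⟩
    · exfalso
      apply hb₁ s₀ hs₀
      have hb₁' : b₁ = (-(a / b)) • o := by
        have : b • b₁ = -(a • o) := eq_neg_of_add_eq_zero_right hab
        calc b₁ = b⁻¹ • (b • b₁) := by rw [smul_smul, inv_mul_cancel₀ hb, one_smul]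
          _ = (-(a / b)) • o := by rw [this, smul_neg, smul_smul, ← neg_smul]; ring_nf
      rw [hb₁', dotProduct_smul, dotProduct_comm, dot_cross_self, smul_zero]
  obtain ⟨i₂, hi₂⟩ := Function.ne_iff.mp hw
  set b₂ : Fin 3 → k := Pi.single i₂ 1 with hb₂
  have hdet3 : o ⬝ᵥ (b₁ ⨯₃ b₂) ≠ 0 := by
    rw [triple_product_permutation, triple_product_permutation, hb₂, dotProduct_comm,
      dotProduct_single_one]
    exact hi₂
  -- the basis matrix with columns `o, b₁, b₂`
  set B : Matrix (Fin 3) (Fin 3) k := Matrix.of fun i j => ![o, b₁, b₂] j i with hB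
  have hBdet : B.det ≠ 0 := by
    have : B = (Matrix.of ![o, b₁, b₂])ᵀ := by
      ext i j; rfl
    rw [this, Matrix.det_transpose]
    rw [triple_product_eq_det] at hdet3
    exact hdet3
  have hBu : IsUnit B.det := isUnit_iff_ne_zero.mpr hBdet
  have hBe0 : B *ᵥ Pi.single 0 1 = o := by
    funext i; rw [Matrix.mulVec_single_one]; rfl
  have hBe1 : B *ᵥ Pi.single 1 1 = b₁ := by
    funext i; rw [Matrix.mulVec_single_one]; rfl
  -- Step 4: substituted forms
  set g' := aeval (fun i => ∑ j, C (B i j) * X j) g with hg'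
  set h' := aeval (fun i => ∑ j, C (B i j) * X j) h with hh'
  have hg'hom : g'.IsHomogeneous e := isHomogeneous_linSubst B hg
  have hh'hom : h'.IsHomogeneous e' := isHomogeneous_linSubst B hh
  have hrel' : IsRelPrime g' h' := isRelPrime_linSubst hBu hrel
  have hcoeff : coeff (Finsupp.single 0 e) g' ≠ 0 := by
    rw [← eval_single_one_of_isHomogeneous hg'hom, hg', eval_linSubst, hBe0]
    exact ho.1
  -- Step 5: transported points
  have hBinv : ∀ s, B *ᵥ (B⁻¹ *ᵥ s) = s := fun s => by
    rw [Matrix.mulVec_mulVec, Matrix.mul_nonsing_inv B hBu, Matrix.one_mulVec]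
  have hinjB : Function.Injective fun s : Fin 3 → k => B⁻¹ *ᵥ s := by
    intro s s' hss'
    rw [← hBinv s, ← hBinv s']
    exact congrArg (fun y => B *ᵥ y) hss'
  set T' := T.image fun s => B⁻¹ *ᵥ s with hT'
  have hmem : ∀ y ∈ T', ∃ s ∈ T, y = B⁻¹ *ᵥ s := fun y hy => by
    obtain ⟨s, hs, rfl⟩ := Finset.mem_image.mp hy
    exact ⟨s, hs, rfl⟩
  have hcard : T'.card = T.card := Finset.card_image_of_injective _ hinjB
  rw [← hcard]
  refine card_le_mul_of_normalized hg'hom hh'hom he hrel' hcoeff T' ?_ ?_ ?_ ?_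
  · intro y hy
    obtain ⟨s, hs, rfl⟩ := hmem y hy
    rw [hg', eval_linSubst, hBinv]
    exact hTg s hs
  · intro y hy
    obtain ⟨s, hs, rfl⟩ := hmem y hy
    rw [hh', eval_linSubst, hBinv]
    exact hTh s hs
  · intro y hy
    obtain ⟨s, hs, rfl⟩ := hmem y hy
    have h1 := hb₁ s hs
    -- `(s × o) · b₁ = det [b₁, s, o] = det [B e₁, B y, B e₀] = det B · y₂`
    rw [dotProduct_comm, triple_product_eq_det, ← hBe1, ← hBe0] at h1
    conv at h1 => rw [← hBinv s]
    rw [det_mulVec_three] at h1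
    have h2 : Matrix.det ![Pi.single 1 1, B⁻¹ *ᵥ s, Pi.single 0 1] = (B⁻¹ *ᵥ s) 2 := by
      simp [Matrix.det_fin_three]
    rw [h2] at h1
    exact right_ne_zero_of_mul h1
  · intro y hy y' hy' hyy'
    obtain ⟨s, hs, rfl⟩ := hmem y hy
    obtain ⟨s', hs', rfl⟩ := hmem y' hy'
    by_contra hne
    have hss' : s ≠ s' := fun h => hne (by rw [h])
    have h1 := ho.2 (s, s') (Finset.mem_offDiag.mpr ⟨hs, hs', hss'⟩)
    simp only at h1
    rw [triple_product_eq_det, ← hBe0] at h1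
    conv at h1 => rw [← hBinv s, ← hBinv s']
    rw [det_mulVec_three] at h1
    have h2 : Matrix.det ![Pi.single 0 1, B⁻¹ *ᵥ s, B⁻¹ *ᵥ s'] =
        (B⁻¹ *ᵥ s) 1 * (B⁻¹ *ᵥ s') 2 - (B⁻¹ *ᵥ s') 1 * (B⁻¹ *ᵥ s) 2 := by
      simp [Matrix.det_fin_three]
      ring
    rw [h2, hyy', sub_self, mul_zero] at h1
    exact h1 rfl

/-- Two distinct points of an affine chart `c · x = 1` are linearly independent (any field).
[folklore] -/
theorem linearIndependent_of_chart' {c y y' : Fin 3 → k} (hy : c ⬝ᵥ y = 1)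
    (hy' : c ⬝ᵥ y' = 1) (hne : y ≠ y') : LinearIndependent k ![y, y'] := by
  rw [LinearIndependent.pair_iff]
  intro s t hst
  have h1 : s + t = 0 := by
    have := congrArg (fun v => c ⬝ᵥ v) hst
    simp only [dotProduct_add, dotProduct_smul, smul_eq_mul, dotProduct_zero, hy, hy',
      mul_one] at this
    exact this
  have ht : t = -s := by linear_combination h1
  rw [ht, neg_smul, ← sub_eq_add_neg, ← smul_sub, smul_eq_zero, sub_eq_zero] at hst
  rcases hst with hs | hyy
  · exact ⟨hs, by rw [ht, hs, neg_zero]⟩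
  · exact absurd hyy hne

/-- **Weak Bézout theorem on an affine chart** (Gibson 1998, Lemma 14.4: two curves of degrees
`e, e'` in `ℙ²` with no common component meet in at most finitely many, indeed `≤ e e'`,
points). For relatively prime ternary forms `g ≠ 0` of degree `e ≥ 1` and `h` of degree `e'`
over an infinite field and any chart covector `c`, the set of common zeros `x ∈ k³` of `g, h`
with `c · x = 1` is finite and has at most `e e'` elements. [cite: Gibson1998, §14.4 Lemma 14.4] -/
theorem planeBezout_chart [Infinite k] {g h : MvPolynomial (Fin 3) k} {e e' : ℕ}
    (hg : g.IsHomogeneous e) (hh : h.IsHomogeneous e') (he : e ≠ 0) (hg0 : g ≠ 0)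
    (hrel : IsRelPrime g h) (c : Fin 3 → k) :
    {x | eval x g = 0 ∧ eval x h = 0 ∧ c ⬝ᵥ x = 1}.Finite ∧
      {x | eval x g = 0 ∧ eval x h = 0 ∧ c ⬝ᵥ x = 1}.ncard ≤ e * e' := by
  set S := {x | eval x g = 0 ∧ eval x h = 0 ∧ c ⬝ᵥ x = 1} with hS
  -- every finite subset of `S` has at most `e e'` elements
  have key : ∀ T : Finset (Fin 3 → k), ↑T ⊆ S → T.card ≤ e * e' := by
    intro T hT
    have hmem : ∀ y ∈ T, eval y g = 0 ∧ eval y h = 0 ∧ c ⬝ᵥ y = 1 := fun y hy => hT hy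
    refine planeBezout_card_le hg hh he hg0 hrel T (fun y hy => (hmem y hy).1)
      (fun y hy => (hmem y hy).2.1) (fun y hy h0 => ?_) (fun y hy y' hy' hne => ?_)
    · have := (hmem y hy).2.2
      rw [h0, dotProduct_zero] at this
      exact zero_ne_one this
    · exact linearIndependent_of_chart' (hmem y hy).2.2 (hmem y' hy').2.2 hne
  have hfin : S.Finite := by
    by_contra hinf
    obtain ⟨T, hT, hcard⟩ := Set.Infinite.exists_subset_card_eq hinf (e * e' + 1)
    have := key T hT
    omega
  refine ⟨hfin, ?_⟩
  rw [Set.ncard_eq_toFinset_card _ hfin]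
  exact key _ (by simp)

end CoordinateChange

/-! ### Factors of forms are forms -/

section HomogeneousFactors

variable {k : Type*} [Field k] {σ : Type*}

/-- **A factor of a non-zero form is a form** (compare lowest and highest homogeneous
components: over a domain the lowest component of a product is the product of the lowest
components). [folklore] -/
theorem isHomogeneous_of_mul_isHomogeneous {φ ψ : MvPolynomial σ k} {n : ℕ}
    (h : (φ * ψ).IsHomogeneous n) (h0 : φ * ψ ≠ 0) : φ.IsHomogeneous φ.totalDegree := by
  classical
  have hφ0 : φ ≠ 0 := left_ne_zero_of_mul h0
  have hψ0 : ψ ≠ 0 := right_ne_zero_of_mul h0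
  have hneφ : (φ.support.image Finsupp.degree).Nonempty :=
    Finset.image_nonempty.mpr (support_nonempty.mpr hφ0)
  have hneψ : (ψ.support.image Finsupp.degree).Nonempty :=
    Finset.image_nonempty.mpr (support_nonempty.mpr hψ0)
  set a := (φ.support.image Finsupp.degree).min' hneφ with ha
  set b := (ψ.support.image Finsupp.degree).min' hneψ with hb
  have ha_le : ∀ d ∈ φ.support, a ≤ d.degree := fun d hd =>
    Finset.min'_le _ _ (Finset.mem_image_of_mem _ hd)
  have hb_le : ∀ d ∈ ψ.support, b ≤ d.degree := fun d hd =>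
    Finset.min'_le _ _ (Finset.mem_image_of_mem _ hd)
  obtain ⟨da, hda, hdadeg⟩ : ∃ d ∈ φ.support, d.degree = a := by
    simpa only [Finset.mem_image] using Finset.min'_mem _ hneφ
  obtain ⟨db, hdb, hdbdeg⟩ : ∃ d ∈ ψ.support, d.degree = b := by
    simpa only [Finset.mem_image] using Finset.min'_mem _ hneψ
  -- components below the minimal degrees vanish
  have hcompφ : ∀ i < a, homogeneousComponent i φ = 0 := fun i hi =>
    homogeneousComponent_eq_zero' _ _ fun d hd => by have := ha_le d hd; omega
  have hcompψ : ∀ j < b, homogeneousComponent j ψ = 0 := fun j hj =>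
    homogeneousComponent_eq_zero' _ _ fun d hd => by have := hb_le d hd; omega
  -- the lowest components are non-zero
  have hφa : homogeneousComponent a φ ≠ 0 := by
    intro h0'
    have := coeff_homogeneousComponent a φ da
    rw [h0', MvPolynomial.coeff_zero, if_pos hdadeg] at this
    exact (mem_support_iff.mp hda) this.symm
  have hψb : homogeneousComponent b ψ ≠ 0 := by
    intro h0'
    have := coeff_homogeneousComponent b ψ db
    rw [h0', MvPolynomial.coeff_zero, if_pos hdbdeg] at this
    exact (mem_support_iff.mp hdb) this.symm
  -- the `(a + b)`-component of the product
  have ha_range : a ∈ Finset.range (φ.totalDegree + 1) := by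
    rw [Finset.mem_range, Nat.lt_succ_iff, ← hdadeg]
    exact le_totalDegree hda
  have hb_range : b ∈ Finset.range (ψ.totalDegree + 1) := by
    rw [Finset.mem_range, Nat.lt_succ_iff, ← hdbdeg]
    exact le_totalDegree hdb
  have hterm : ∀ i j, homogeneousComponent (a + b)
      (homogeneousComponent i φ * homogeneousComponent j ψ) =
        if a + b = i + j then homogeneousComponent i φ * homogeneousComponent j ψ else 0 :=
    fun i j => homogeneousComponent_of_mem
      ((homogeneousComponent_isHomogeneous i φ).mul (homogeneousComponent_isHomogeneous j ψ))
  have hkey : homogeneousComponent (a + b) (φ * ψ) =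
      homogeneousComponent a φ * homogeneousComponent b ψ := by
    conv_lhs => rw [← sum_homogeneousComponent φ, ← sum_homogeneousComponent ψ]
    rw [Finset.sum_mul_sum, map_sum]
    simp_rw [map_sum, hterm]
    rw [Finset.sum_eq_single a]
    · rw [Finset.sum_eq_single b]
      · rw [if_pos rfl]
      · intro j _ hjb
        rw [if_neg (by omega)]
      · intro hb'
        exact absurd hb_range hb'
    · intro i _ hia
      refine Finset.sum_eq_zero fun j _ => ?_
      split_ifs with hij
      · rcases lt_or_gt_of_ne hia with hi | hi
        · rw [hcompφ i hi, zero_mul]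
        · rw [hcompψ j (by omega), mul_zero]
      · rfl
    · intro ha'
      exact absurd ha_range ha'
  have hab : n = a + b := by
    have h1 : homogeneousComponent (a + b) (φ * ψ) ≠ 0 := by
      rw [hkey]; exact mul_ne_zero hφa hψb
    rw [homogeneousComponent_of_mem h] at h1
    by_contra hne
    exact h1 (if_neg (Ne.symm hne) ▸ rfl)
  -- compare with the top degrees
  have htop : n = φ.totalDegree + ψ.totalDegree := by
    rw [← h.totalDegree h0, totalDegree_mul_of_isDomain hφ0 hψ0]
  have haA : a = φ.totalDegree := by
    have h1 : a ≤ φ.totalDegree := hdadeg ▸ le_totalDegree hda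
    have h2 : b ≤ ψ.totalDegree := hdbdeg ▸ le_totalDegree hdb
    omega
  -- conclude
  intro d hd
  have hw : Finsupp.weight (1 : σ → ℕ) d = d.degree := by
    rw [Finsupp.degree_eq_weight_one]
    rfl
  rw [hw]
  have h1 := ha_le d (mem_support_iff.mpr hd)
  have h2 : d.degree ≤ φ.totalDegree := le_totalDegree (mem_support_iff.mpr hd)
  omega

/-- A divisor of a non-zero form is a form. [folklore] -/
theorem isHomogeneous_of_dvd_isHomogeneous {p f : MvPolynomial σ k} {n : ℕ}
    (hf : f.IsHomogeneous n) (hf0 : f ≠ 0) (hp : p ∣ f) : p.IsHomogeneous p.totalDegree := by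
  obtain ⟨q, rfl⟩ := hp
  exact isHomogeneous_of_mul_isHomogeneous hf hf0

end HomogeneousFactors

/-! ### The polar set of a ternary form: reduction to prime factors and the class inequality -/

section PolarSet

open Matrix

/-- On the polar set `T_f(a, b, c)` the polar form `Σᵢ (a × b)ᵢ ∂ᵢ f` vanishes
(`∇f(x) ∈ ℂa + ℂb` is orthogonal to `a × b`). [folklore] -/
theorem eval_polarForm_eq_zero_of_mem_polarSet {f : MvPolynomial (Fin 3) ℂ}
    {a b c x : Fin 3 → ℂ} (hx : x ∈ polarSet f a b c) :
    eval x (∑ i, C ((a ⨯₃ b) i) * pderiv i f) = 0 := by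
  obtain ⟨-, -, ⟨s, t, hst⟩, -⟩ := hx
  simp only [map_sum, map_mul, eval_C, hst]
  have h1 : (a ⨯₃ b) ⬝ᵥ a = 0 := by rw [dotProduct_comm]; exact dot_self_cross a b
  have h2 : (a ⨯₃ b) ⬝ᵥ b = 0 := by rw [dotProduct_comm]; exact dot_cross_self a b
  calc ∑ i, (a ⨯₃ b) i * (s * a i + t * b i)
      = s * ((a ⨯₃ b) ⬝ᵥ a) + t * ((a ⨯₃ b) ⬝ᵥ b) := by
        simp only [dotProduct, Finset.mul_sum, ← Finset.sum_add_distrib]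
        exact Finset.sum_congr rfl fun i _ => by ring
    _ = 0 := by rw [h1, h2, mul_zero, mul_zero, add_zero]

/-- **Polar points of a product.** A polar point of `g h` (where, by definition, `∇(gh) ≠ 0`)
is a polar point of exactly one factor, at which the other factor does not vanish. [folklore] -/
theorem mem_polarSet_mul {σ : Type*} [Fintype σ] {g h : MvPolynomial σ ℂ} {a b c x : σ → ℂ}
    (hx : x ∈ polarSet (g * h) a b c) :
    (x ∈ polarSet g a b c ∧ eval x h ≠ 0) ∨ (x ∈ polarSet h a b c ∧ eval x g ≠ 0) := by
  obtain ⟨h0, ⟨i₀, hi₀⟩, ⟨s, t, hst⟩, hc⟩ := hx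
  rw [map_mul, mul_eq_zero] at h0
  have hder : ∀ i, eval x (pderiv i (g * h)) =
      eval x (pderiv i g) * eval x h + eval x g * eval x (pderiv i h) := by
    intro i
    rw [pderiv_mul, map_add, map_mul, map_mul]
  rcases h0 with hg0 | hh0
  · left
    have hh : eval x h ≠ 0 := by
      intro hh0
      apply hi₀
      rw [hder, hg0, hh0, mul_zero, zero_mul, add_zero]
    refine ⟨⟨hg0, ⟨i₀, fun h0 => hi₀ ?_⟩, ⟨s / eval x h, t / eval x h, fun i => ?_⟩, hc⟩, hh⟩
    · rw [hder, h0, hg0, zero_mul, zero_mul, add_zero]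
    · have := hst i
      rw [hder, hg0, zero_mul, add_zero] at this
      rw [div_mul_eq_mul_div, div_mul_eq_mul_div, ← add_div, eq_div_iff hh, this]
  · right
    have hg : eval x g ≠ 0 := by
      intro hg0
      apply hi₀
      rw [hder, hg0, hh0, mul_zero, zero_mul, add_zero]
    refine ⟨⟨hh0, ⟨i₀, fun h0 => hi₀ ?_⟩, ⟨s / eval x g, t / eval x g, fun i => ?_⟩, hc⟩, hg⟩
    · rw [hder, h0, hh0, mul_zero, mul_zero, add_zero]
    · have := hst i
      rw [hder, hh0, mul_zero, zero_add] at this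
      rw [div_mul_eq_mul_div, div_mul_eq_mul_div, ← add_div, eq_div_iff hg, mul_comm, this]

/-- A proper power has empty polar set (`∇(gⁿ) = n gⁿ⁻¹ ∇g` vanishes on `V(g)`). [folklore] -/
theorem polarSet_pow_eq_empty {σ : Type*} [Fintype σ] (g : MvPolynomial σ ℂ) {n : ℕ} (hn : 2 ≤ n)
    (a b c : σ → ℂ) : polarSet (g ^ n) a b c = ∅ := by
  ext x
  simp only [Set.mem_empty_iff_false, iff_false]
  rintro ⟨h0, ⟨i, hi⟩, -, -⟩
  apply hi
  rw [map_pow, pow_eq_zero_iff (by omega)] at h0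
  have : pderiv i (g ^ n) = n • g ^ (n - 1) • pderiv i g := Derivation.leibniz_pow _ _ _
  rw [this, map_nsmul, smul_eq_mul, map_mul, map_pow, h0, zero_pow (by omega), zero_mul,
    smul_zero]

/-- Constants have empty polar set. [folklore] -/
theorem polarSet_C {σ : Type*} [Fintype σ] (r : ℂ) (a b c : σ → ℂ) :
    polarSet (C r : MvPolynomial σ ℂ) a b c = ∅ := by
  ext x
  simp [polarSet]

/-- **Reduction to the multiplicity-one factors.** The polar set of `r · Π_{p ∈ P} p^{n_p}` is
contained in the union of the polar sets of the factors `p` with `n_p = 1`. [folklore] -/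
theorem polarSet_C_mul_prod_pow_subset {σ : Type*} [Fintype σ] (P : Finset (MvPolynomial σ ℂ))
    (n : MvPolynomial σ ℂ → ℕ) (r : ℂ) (a b c : σ → ℂ) :
    polarSet (C r * ∏ p ∈ P, p ^ n p) a b c ⊆
      ⋃ p ∈ P.filter (fun p => n p = 1), polarSet p a b c := by
  classical
  induction P using Finset.induction_on with
  | empty =>
    rw [Finset.prod_empty, mul_one, polarSet_C]
    exact Set.empty_subset _
  | insert q P hq ih =>
    intro x hx
    rw [Finset.prod_insert hq, mul_left_comm] at hx
    rw [Set.mem_iUnion₂]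
    rcases mem_polarSet_mul hx with ⟨hxq, -⟩ | ⟨hxP, -⟩
    · have hnq : n q = 1 := by
        by_contra hne
        rcases Nat.lt_or_ge (n q) 2 with hlt | hge
        · have h0 : n q = 0 := by omega
          rw [h0, pow_zero, ← C_1, polarSet_C] at hxq
          exact hxq
        · rw [polarSet_pow_eq_empty q hge] at hxq
          exact hxq
      rw [hnq, pow_one] at hxq
      exact ⟨q, Finset.mem_filter.mpr ⟨Finset.mem_insert_self q P, hnq⟩, hxq⟩
    · obtain ⟨p, hp, hxp⟩ := Set.mem_iUnion₂.mp (ih hxP)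
      rw [Finset.mem_filter] at hp
      exact ⟨p, Finset.mem_filter.mpr ⟨Finset.mem_insert_of_mem hp.1, hp.2⟩, hxp⟩

/-- Two distinct points of an affine chart `c · x = 1` are linearly independent. [folklore] -/
theorem linearIndependent_of_chart {c y y' : Fin 3 → ℂ} (hy : ∑ i, c i * y i = 1)
    (hy' : ∑ i, c i * y' i = 1) (hne : y ≠ y') : LinearIndependent ℂ ![y, y'] := by
  rw [LinearIndependent.pair_iff]
  intro s t hst
  have h1 : s + t = 0 := by
    have := congrArg (fun v => c ⬝ᵥ v) hst
    simp only [dotProduct_add, dotProduct_smul, smul_eq_mul, dotProduct_zero] at this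
    change s * (∑ i, c i * y i) + t * (∑ i, c i * y' i) = 0 at this
    rwa [hy, hy', mul_one, mul_one] at this
  have ht : t = -s := by linear_combination h1
  rw [ht, neg_smul, ← sub_eq_add_neg, ← smul_sub, smul_eq_zero, sub_eq_zero] at hst
  rcases hst with hs | hyy
  · exact ⟨hs, by rw [ht, hs, neg_zero]⟩
  · exact absurd hyy hne

/-- The prime factorisation of a non-zero polynomial over `ℂ`, as an identity
`f = r · Π_{p ∈ factors f} p ^ (multiplicity of p)`. [folklore] -/
theorem eq_C_mul_prod_factors_pow {σ : Type*} [DecidableEq (MvPolynomial σ ℂ)]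
    {f : MvPolynomial σ ℂ} (hf0 : f ≠ 0) :
    ∃ r : ℂ, f = C r * ∏ p ∈ (UniqueFactorizationMonoid.factors f).toFinset,
      p ^ (UniqueFactorizationMonoid.factors f).count p := by
  obtain ⟨u, hu⟩ := UniqueFactorizationMonoid.factors_prod hf0
  obtain ⟨r, -, hur⟩ := isUnit_iff_eq_C_of_isReduced.mp u.isUnit
  refine ⟨r, ?_⟩
  conv_lhs => rw [← hu, hur, Finset.prod_multiset_count]
  exact mul_comm _ _

/-- **Reduction of the polar set to the prime factors of multiplicity one.** [folklore] -/
theorem polarSet_subset_iUnion_factors {σ : Type*} [Fintype σ] [DecidableEq (MvPolynomial σ ℂ)]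
    {f : MvPolynomial σ ℂ} (hf0 : f ≠ 0) (a b c : σ → ℂ) :
    polarSet f a b c ⊆ ⋃ p ∈ (UniqueFactorizationMonoid.factors f).toFinset.filter
      (fun p => (UniqueFactorizationMonoid.factors f).count p = 1), polarSet p a b c := by
  obtain ⟨r, hfac⟩ := eq_C_mul_prod_factors_pow hf0
  conv_lhs => rw [hfac]
  exact polarSet_C_mul_prod_pow_subset _ _ r a b c

/-- **A prime factor of a ternary form and its polar form.** Let `f ≠ 0` be a ternary form with
`f(o) ≠ 0` and `p` a prime factor of `f`. Then `p` is a form of positive degree `e_p`, its polar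
form `q = Σᵢ oᵢ ∂ᵢ p` is a form of degree `e_p − 1`, and `p, q` are relatively prime: by Euler's
identity `q(o) = e_p · p(o) ≠ 0`, so `q ≠ 0` has degree `< e_p` and the prime `p` cannot
divide it. [folklore] -/
theorem isRelPrime_polarForm_of_mem_factors {f : MvPolynomial (Fin 3) ℂ} {d : ℕ}
    (hf : f.IsHomogeneous d) (hf0 : f ≠ 0) {o : Fin 3 → ℂ} (ho : eval o f ≠ 0)
    {p : MvPolynomial (Fin 3) ℂ} (hp : p ∈ UniqueFactorizationMonoid.factors f) :
    p.IsHomogeneous p.totalDegree ∧ p.totalDegree ≠ 0 ∧ p ≠ 0 ∧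
      (∑ i, C (o i) * pderiv i p).IsHomogeneous (p.totalDegree - 1) ∧
      IsRelPrime p (∑ i, C (o i) * pderiv i p) := by
  have hprime : Prime p := UniqueFactorizationMonoid.prime_of_factor p hp
  have hdvd : p ∣ f := UniqueFactorizationMonoid.dvd_of_mem_factors hp
  have hhom : p.IsHomogeneous p.totalDegree := isHomogeneous_of_dvd_isHomogeneous hf hf0 hdvd
  have hpos : p.totalDegree ≠ 0 := by
    intro h0
    apply hprime.not_unit
    rw [totalDegree_eq_zero_iff_eq_C] at h0
    rw [h0]
    refine isUnit_iff_eq_C_of_isReduced.mpr ⟨coeff 0 p, ?_, rfl⟩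
    exact isUnit_iff_ne_zero.mpr fun hc => hprime.ne_zero (by rw [h0, hc, C_0])
  have hpo : eval o p ≠ 0 := fun h0 => ho (by
    obtain ⟨q, hq⟩ := hdvd
    rw [hq, map_mul, h0, zero_mul])
  set q := ∑ i, C (o i) * pderiv i p with hq
  have hqhom : q.IsHomogeneous (p.totalDegree - 1) :=
    IsHomogeneous.sum _ _ _ fun i _ => (hhom.pderiv).C_mul _
  have hqo : eval o q ≠ 0 := by
    have heuler := hhom.sum_X_mul_pderiv
    have h1 : eval o q = eval o (∑ i, X i * pderiv i p) := by
      simp only [hq, map_sum, map_mul, eval_C, eval_X]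
    rw [h1, heuler, map_nsmul, nsmul_eq_mul]
    exact mul_ne_zero (Nat.cast_ne_zero.mpr hpos) hpo
  have hq0 : q ≠ 0 := fun h0 => hqo (by rw [h0, map_zero])
  have hrel : IsRelPrime p q := by
    rw [hprime.irreducible.isRelPrime_iff_not_dvd]
    intro hpq
    have h1 := totalDegree_le_of_dvd_of_isDomain hpq hq0
    have h2 := hqhom.totalDegree_le
    omega
  exact ⟨hhom, hpos, hprime.ne_zero, hqhom, hrel⟩

/-- **Finiteness of the polar set.** For a non-zero ternary form `f` and pencil/chart data with
`f(a × b) ≠ 0`, the polar set `T_f(a, b, c)` is finite (it lies in the union, over the prime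
factors `p` of `f`, of the common zeros of `p` and its polar form on the chart, each finite by
the weak Bézout theorem `planeBezout_chart`). [cite: Gibson1998, §14.4 Lemma 14.4] -/
theorem polarSet_finite_of_eval_cross_ne_zero {f : MvPolynomial (Fin 3) ℂ} {d : ℕ}
    (hf : f.IsHomogeneous d) (hf0 : f ≠ 0) (a b c : Fin 3 → ℂ) (hab : eval (a ⨯₃ b) f ≠ 0) :
    (polarSet f a b c).Finite := by
  classical
  haveI : Infinite ℂ := CharZero.infinite ℂ
  refine Set.Finite.subset (Set.Finite.biUnion (Finset.finite_toSet _) fun p hp => ?_)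
    (polarSet_subset_iUnion_factors hf0 a b c)
  obtain ⟨hp, -⟩ := Finset.mem_filter.mp hp
  obtain ⟨hhom, hpos, hp0, hqhom, hrel⟩ :=
    isRelPrime_polarForm_of_mem_factors hf hf0 hab (Multiset.mem_toFinset.mp hp)
  refine Set.Finite.subset (planeBezout_chart hhom hqhom hpos hp0 hrel c).1 fun x hx => ?_
  exact ⟨hx.1, eval_polarForm_eq_zero_of_mem_polarSet hx, hx.2.2.2⟩

/-- **Class inequality for plane curves (Plücker: class ≤ d(d−1)).** Let `f` be a non-zero
ternary form of degree `d` over `ℂ` and `(a, b, c)` pencil/chart data with `f(a × b) ≠ 0` (the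
base point `[a × b]` of the pencil `{a·x = λ b·x}` off the curve). Then the polar set
`T_f(a, b, c)` (finite, `polarSet_finite_of_eval_cross_ne_zero`) has at most `d(d − 1)` points:
a polar point lies on exactly one prime factor `p` of `f`, of multiplicity one, and is a common
zero of `p` and its polar form `q_p = Σᵢ (a × b)ᵢ ∂ᵢp`, which is prime to `p`
(`isRelPrime_polarForm_of_mem_factors`); by the plane Bézout inequality
(`planeBezout_card_le`) the prime `p` contributes at most `deg p (deg p − 1)` points, and
`Σ deg p ≤ d`. [cite: Gibson1998, §14.4 Lemma 14.10] -/
theorem ncard_polarSet_le_of_isHomogeneous {f : MvPolynomial (Fin 3) ℂ} {d : ℕ}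
    (hf : f.IsHomogeneous d) (hf0 : f ≠ 0) (a b c : Fin 3 → ℂ) (hab : eval (a ⨯₃ b) f ≠ 0) :
    (polarSet f a b c).ncard ≤ d * (d - 1) := by
  classical
  haveI : Infinite ℂ := CharZero.infinite ℂ
  have hfin := polarSet_finite_of_eval_cross_ne_zero hf hf0 a b c hab
  set o := a ⨯₃ b with ho
  set T := hfin.toFinset with hT
  set P := (UniqueFactorizationMonoid.factors f).toFinset with hP
  set n : MvPolynomial (Fin 3) ℂ → ℕ := fun p => (UniqueFactorizationMonoid.factors f).count p
    with hn
  obtain ⟨r, hfac⟩ := eq_C_mul_prod_factors_pow hf0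
  -- degree bookkeeping: `d = Σ_{p ∈ P} n_p · deg p`
  have hdeg : d = ∑ p ∈ P, p.totalDegree * n p := by
    have h1 : (C r * ∏ p ∈ P, p ^ n p).IsHomogeneous (0 + ∑ p ∈ P, p.totalDegree * n p) :=
      (isHomogeneous_C _ r).mul (IsHomogeneous.prod P (fun p => p ^ n p)
        (fun p => p.totalDegree * n p) (fun p hp => (isRelPrime_polarForm_of_mem_factors hf
          hf0 hab (Multiset.mem_toFinset.mp hp)).1.pow (n p)))
    rw [zero_add, ← hfac] at h1
    exact hf.inj_right h1 hf0
  -- the per-prime count (plane Bézout for `p` and its polar form)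
  have hcount : ∀ p ∈ P, (T.filter (· ∈ polarSet p a b c)).card ≤
      p.totalDegree * (p.totalDegree - 1) := by
    intro p hp
    obtain ⟨hhom, hpos, hp0, hqhom, hrel⟩ :=
      isRelPrime_polarForm_of_mem_factors hf hf0 hab (Multiset.mem_toFinset.mp hp)
    refine planeBezout_card_le hhom hqhom hpos hp0 hrel _ ?_ ?_ ?_ ?_
    · intro y hy
      exact ((Finset.mem_filter.mp hy).2).1
    · intro y hy
      exact eval_polarForm_eq_zero_of_mem_polarSet (Finset.mem_filter.mp hy).2
    · intro y hy h0
      have hc := ((Finset.mem_filter.mp hy).2).2.2.2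
      rw [h0] at hc
      simp at hc
    · intro y hy y' hy' hne
      exact linearIndependent_of_chart ((Finset.mem_filter.mp hy).2).2.2.2
        ((Finset.mem_filter.mp hy').2).2.2.2 hne
  -- assemble
  have hcover : T ⊆ (P.filter fun p => n p = 1).biUnion
      fun p => T.filter (· ∈ polarSet p a b c) := by
    intro x hx
    have hx' : x ∈ polarSet f a b c := (Set.Finite.mem_toFinset hfin).mp hx
    obtain ⟨p, hp, hxp⟩ := Set.mem_iUnion₂.mp (polarSet_subset_iUnion_factors hf0 a b c hx')
    exact Finset.mem_biUnion.mpr ⟨p, hp, Finset.mem_filter.mpr ⟨hx, hxp⟩⟩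
  have hS : ∑ p ∈ P.filter (fun p => n p = 1), p.totalDegree ≤ d := by
    calc ∑ p ∈ P.filter (fun p => n p = 1), p.totalDegree
        = ∑ p ∈ P.filter (fun p => n p = 1), p.totalDegree * n p :=
          Finset.sum_congr rfl fun p hp => by rw [(Finset.mem_filter.mp hp).2, mul_one]
      _ ≤ ∑ p ∈ P, p.totalDegree * n p :=
          Finset.sum_le_sum_of_subset (Finset.filter_subset _ _)
      _ = d := hdeg.symm
  calc (polarSet f a b c).ncard = T.card := Set.ncard_eq_toFinset_card _ hfin
    _ ≤ ((P.filter fun p => n p = 1).biUnion fun p => T.filter (· ∈ polarSet p a b c)).card :=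
        Finset.card_le_card hcover
    _ ≤ ∑ p ∈ P.filter (fun p => n p = 1), (T.filter (· ∈ polarSet p a b c)).card :=
        Finset.card_biUnion_le
    _ ≤ ∑ p ∈ P.filter (fun p => n p = 1), p.totalDegree * (p.totalDegree - 1) :=
        Finset.sum_le_sum fun p hp => hcount p (Finset.mem_filter.mp hp).1
    _ ≤ ∑ p ∈ P.filter (fun p => n p = 1), p.totalDegree * (d - 1) :=
        Finset.sum_le_sum fun p hp => Nat.mul_le_mul_left _ (Nat.sub_le_sub_right
          ((Finset.single_le_sum (fun _ _ => Nat.zero_le _) hp).trans hS) 1)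
    _ = (∑ p ∈ P.filter (fun p => n p = 1), p.totalDegree) * (d - 1) :=
        (Finset.sum_mul _ _ _).symm
    _ ≤ d * (d - 1) := Nat.mul_le_mul_right _ hS

end PolarSet

/-! ### Genericity polynomial, transfer to a `3`-element index type, and the `N = 3` case -/

section CardThree

open Matrix

/-- **Generic class inequality, `σ = Fin 3`.** For a ternary form `f` of degree `d` there is a
non-zero polynomial `Φ` in the pencil/chart data `u = (a, b, c)` — namely `Φ(u) = f(a × b)`
(or `1` if `f = 0`) — such that `Φ(u) ≠ 0` implies `#T_f(a, b, c) ≤ d(d − 1)`. [folklore] -/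
theorem exists_generic_ncard_polarSet_le_fin_three {f : MvPolynomial (Fin 3) ℂ} {d : ℕ}
    (hf : f.IsHomogeneous d) :
    ∃ Φ : MvPolynomial (Fin 3 × Fin 3) ℂ, Φ ≠ 0 ∧ ∀ u : Fin 3 × Fin 3 → ℂ, eval u Φ ≠ 0 →
      (polarSet f (fun i => u (0, i)) (fun i => u (1, i)) (fun i => u (2, i))).ncard ≤
        d * (d - 1) := by
  classical
  haveI : Infinite ℂ := CharZero.infinite ℂ
  by_cases hf0 : f = 0
  · refine ⟨1, one_ne_zero, fun u _ => ?_⟩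
    rw [hf0, polarSet_zero, Set.ncard_empty]
    exact Nat.zero_le _
  -- the cross product of the first two rows of `u`, as polynomials
  set cr : Fin 3 → MvPolynomial (Fin 3 × Fin 3) ℂ :=
    ![X (0, 1) * X (1, 2) - X (0, 2) * X (1, 1), X (0, 2) * X (1, 0) - X (0, 0) * X (1, 2),
      X (0, 0) * X (1, 1) - X (0, 1) * X (1, 0)] with hcr
  have hcr_eval : ∀ u : Fin 3 × Fin 3 → ℂ,
      (fun i => eval u (cr i)) = (fun i => u (0, i)) ⨯₃ (fun i => u (1, i)) := by
    intro u
    funext i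
    fin_cases i <;> simp [hcr, cross_apply]
  refine ⟨aeval cr f, ?_, fun u hu => ?_⟩
  · -- non-vanishing: pick `v` with `f(v) ≠ 0`, `v₀ ≠ 0`, and solve `a × b = v`
    obtain ⟨v, hv⟩ := exists_point_eval_ne_zero (mul_ne_zero hf0 (X_ne_zero (0 : Fin 3)))
    rw [map_mul, MvPolynomial.eval_X, mul_ne_zero_iff] at hv
    set a : Fin 3 → ℂ := ![v 1, -v 0, 0] with ha
    set b : Fin 3 → ℂ := ![v 2 / v 0, 0, -1] with hb
    have hab : a ⨯₃ b = v := by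
      rw [ha, hb, cross_apply]
      funext i
      fin_cases i
      · simp
      · simp
      · simp
        rw [mul_div_cancel₀ _ hv.2]
    intro h0
    have := congrArg (eval (fun ij : Fin 3 × Fin 3 => ![a, b, 0] ij.1 ij.2)) h0
    rw [map_zero, eval_aeval_eq_eval, hcr_eval] at this
    simp only [Matrix.cons_val_zero, Matrix.cons_val_one] at this
    apply hv.1
    rw [← hab]
    exact this
  · rw [eval_aeval_eq_eval, hcr_eval] at hu
    exact ncard_polarSet_le_of_isHomogeneous hf hf0 _ _ _ hu

/-- Renaming the variables along `e : σ ≃ τ` transports polar sets. [folklore] -/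
theorem comp_mem_polarSet_rename_iff {σ τ : Type*} [Fintype σ] [Fintype τ] (e : σ ≃ τ)
    (f : MvPolynomial σ ℂ) (a b c x : σ → ℂ) :
    x ∘ e.symm ∈ polarSet (rename e f) (a ∘ e.symm) (b ∘ e.symm) (c ∘ e.symm) ↔
      x ∈ polarSet f a b c := by
  have hev : ∀ p : MvPolynomial σ ℂ, eval (x ∘ e.symm) (rename e p) = eval x p := by
    intro p
    rw [eval_rename]
    have hfun : (x ∘ e.symm) ∘ e = x := by
      funext i
      simp
    rw [hfun]
  have hpd : ∀ j, eval (x ∘ e.symm) (pderiv j (rename e f)) = eval x (pderiv (e.symm j) f) := by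
    intro j
    conv_lhs => rw [← e.apply_symm_apply j]
    rw [pderiv_rename e.injective, hev]
  rw [mem_polarSet, mem_polarSet, hev]
  simp only [hpd, Function.comp_apply]
  rw [Equiv.sum_comp e.symm (fun i => c i * x i)]
  constructor
  · rintro ⟨h0, ⟨j, hj⟩, ⟨s, t, hst⟩, hc⟩
    refine ⟨h0, ⟨e.symm j, hj⟩, ⟨s, t, fun i => ?_⟩, hc⟩
    simpa using hst (e i)
  · rintro ⟨h0, ⟨i, hi⟩, ⟨s, t, hst⟩, hc⟩
    refine ⟨h0, ⟨e i, by simpa using hi⟩, ⟨s, t, fun j => hst (e.symm j)⟩, hc⟩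

/-- Renaming the variables along `e : σ ≃ τ` preserves the number of polar points. [folklore] -/
theorem ncard_polarSet_rename {σ τ : Type*} [Fintype σ] [Fintype τ] (e : σ ≃ τ)
    (f : MvPolynomial σ ℂ) (a b c : σ → ℂ) :
    (polarSet (rename e f) (a ∘ e.symm) (b ∘ e.symm) (c ∘ e.symm)).ncard =
      (polarSet f a b c).ncard := by
  have hset : polarSet (rename e f) (a ∘ e.symm) (b ∘ e.symm) (c ∘ e.symm) =
      (fun x : σ → ℂ => x ∘ e.symm) '' polarSet f a b c := by
    ext y
    constructor
    · intro hy
      refine ⟨y ∘ e, (comp_mem_polarSet_rename_iff e f a b c (y ∘ e)).mp ?_, ?_⟩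
      · convert hy using 2
        funext j
        simp
      · funext j
        simp
    · rintro ⟨x, hx, rfl⟩
      exact (comp_mem_polarSet_rename_iff e f a b c x).mpr hx
  rw [hset, Set.ncard_image_of_injective _ ?_]
  intro x x' h
  funext i
  simpa using congr_fun h (e i)

/-- **Generic class inequality for a `3`-element index type** (transfer of
`exists_generic_ncard_polarSet_le_fin_three` along `σ ≃ Fin 3`). [folklore] -/
theorem exists_generic_ncard_polarSet_le_of_card_eq_three {σ : Type} [Fintype σ]
    (hσ : Fintype.card σ = 3) {f : MvPolynomial σ ℂ} {d : ℕ} (hf : f.IsHomogeneous d) :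
    ∃ Φ : MvPolynomial (Fin 3 × σ) ℂ, Φ ≠ 0 ∧ ∀ u : Fin 3 × σ → ℂ, eval u Φ ≠ 0 →
      (polarSet f (fun i => u (0, i)) (fun i => u (1, i)) (fun i => u (2, i))).ncard ≤
        d * (d - 1) := by
  set e : σ ≃ Fin 3 := Fintype.equivFinOfCardEq hσ with he
  obtain ⟨Φ', hΦ', hΦ'b⟩ :=
    exists_generic_ncard_polarSet_le_fin_three (hf.rename_isHomogeneous (f := e))
  refine ⟨rename (Prod.map id e.symm) Φ', ?_, fun u hu => ?_⟩
  · exact (map_ne_zero_iff _ (rename_injective _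
      (Function.Injective.prodMap Function.injective_id e.symm.injective))).mpr hΦ'
  · rw [eval_rename] at hu
    have hb := hΦ'b (u ∘ Prod.map id e.symm) hu
    have key := ncard_polarSet_rename e f (fun i => u (0, i)) (fun i => u (1, i))
      (fun i => u (2, i))
    rw [← key]
    exact hb

end CardThree

end Literature.Computability.AlgebraicComplexity.DeterminantalConormal

namespace Literature.Computability.AlgebraicComplexity

open MvPolynomial

/-- **`Sheshadri2026_polarCount_le` for `N = |σ| = 3` (plane curves).** For a ternary form `f` of
degree `d` with an affine determinantal representation of size `m` (`HasDetRepr f m`), for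
generic pencil/chart data the polar set has at most `B(m, 3) = 3·C(m, 2)` points: by the
Plücker class inequality (`ncard_polarSet_le_of_isHomogeneous`, proved from the projective plane
Bézout inequality `planeBezout_card_le` via the Sylvester resultant) the count is
`≤ d(d − 1)`, and `d ≤ m` (`totalDegree_le_of_hasDetRepr_holds`), so
`d(d − 1) ≤ m(m − 1) = 2·C(m, 2) ≤ 3·C(m, 2)` (`conormalBezout_three`). This is the conclusion of
the named fact `Sheshadri2026_polarCount_le` (arXiv:2606.13628, Thm. 3 (i) in polar-count form)
in its first case `N = 3`; the cases `4 ≤ N ≤ 2m` remain the intersection-theoretic content of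
the cited claim. [cite: Gibson1998, §14.4 Lemma 14.4] -/
theorem Sheshadri2026_polarCount_le_of_card_eq_three {σ : Type} [Fintype σ] [DecidableEq σ]
    (hσ : Fintype.card σ = 3) (f : MvPolynomial σ ℂ) (d m : ℕ) (hf : f.IsHomogeneous d)
    (hm : HasDetRepr f m) :
    ∃ Φ : MvPolynomial (Fin 3 × σ) ℂ, Φ ≠ 0 ∧ ∀ u : Fin 3 × σ → ℂ, eval u Φ ≠ 0 →
      (polarSet f (fun i => u (0, i)) (fun i => u (1, i)) (fun i => u (2, i))).ncard ≤
        conormalBezout m (Fintype.card σ) := by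
  by_cases hf0 : f = 0
  · refine ⟨1, one_ne_zero, fun u _ => ?_⟩
    rw [hf0, polarSet_zero, Set.ncard_empty]
    exact Nat.zero_le _
  obtain ⟨Φ, hΦ, hb⟩ :=
    DeterminantalConormal.exists_generic_ncard_polarSet_le_of_card_eq_three hσ hf
  refine ⟨Φ, hΦ, fun u hu => (hb u hu).trans ?_⟩
  have hdm : d ≤ m := by
    rw [← hf.totalDegree hf0]
    exact totalDegree_le_of_hasDetRepr_holds hm
  rw [hσ, conormalBezout_three, Nat.choose_two_right]
  have h2 := Nat.two_mul_div_two_of_even (Nat.even_mul_pred_self m)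
  calc d * (d - 1) ≤ m * (m - 1) := Nat.mul_le_mul hdm (Nat.sub_le_sub_right hdm 1)
    _ ≤ 3 * (m * (m - 1) / 2) := by omega

end Literature.Computability.AlgebraicComplexity
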